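import Literature.MathematicalPhysics.QuantumFieldTheory.Balaban1983to89.Node00.CriticalOnFibre
import Literature.MathematicalPhysics.QuantumFieldTheory.Balaban1983to89.B15DeterminingSetsB
import Literature.MathematicalPhysics.QuantumFieldTheory.Balaban1983to89.Node00.DomainsOfSeq

/-!
# NODE 00 — «U IS A CRITICAL CONFIGURATION OF (5) ON THE FIBRE 𝔅(𝐁ᵇ, W)» OVER A **BOND-LEVEL** DETERMINING DATUM — F0b of the (E1)∕(iii-b) work plan (director-ym №336∕№338;
# FLAG №16; LOCATE-HSEAM 5d3298b8d191f169): `IsCritOnFibreB`, the old `IsCritOnFibre` as the instance `bondsDet 𝐁` (rfl), the MONOTONICITY in the datum (fewer constrained bonds ⇒ more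
# admissible curves ⇒ STRONGER criticality), the Fermat step «minimal ⇒ critical» over print's classes, and the reading at print's [II] (2.3) datum `lamBondsSeq`

Cell `pub-ymgap`, seat `pub-ymgap-dag-n07-e` g33 (author of the (b)-edition `Node00/CriticalOnFibre`, g8).  `--kind definition` (Literature; count-neutral).  PURELY ADDITIVE: every landed
statement stays landed and true on its own text («print-datum twin ∕ parametrisation of `Node00/CriticalOnFibre` §1–§2; the (b)-instance stays»).  [15] = [Balaban1985Variational];
[III] = [Balaban1988Convergent]; [II] = [Balaban1984PropagatorsII]; [I] = [Balaban1987RG1].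

WHY.  LOCATE-HSEAM (γ): the K0 road's criticality hypothesis `IsCritOnFibre F N K (genSet s.Ω k) W U` quantifies over curves staying in the READING-(b) fibre (agreement on all bonds MEETING
`Γ_j`), print's Prop. 8 ∕ Sect. F need criticality along curves staying in the [II] (2.3) fibre (agreement on `Λ_j` only) — a LARGER curve class.  With the datum a parameter, both are
instances of ONE predicate, and the only relation between instances the road needs is monotonicity: `𝔅₁ ⊆ 𝔅₂ ⇒ (IsCritOnFibreB 𝔅₁ → IsCritOnFibreB 𝔅₂)` (a curve keeping the `𝔅₂`-averages
keeps the `𝔅₁`-averages).  At print's datum `lamBondsSeq s.Ω k ⊆ bondsDet (genSet s.Ω k)` (F0a `lamBondsSeq_subset_bondsDet`, no hypotheses), so the print-instance hypothesis IMPLIES the (b)-instance one — every consumer that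
merely threads criticality is served by a one-line door, and the (2.3)-curve criticality HSEAM used to display is the print instance UNFOLDED (§3 `mem_lamBondsSeq_iff_lamBond`).

WHAT IS HERE (sorry-free).  §1 `IsCritOnFibreB`, `isCritOnFibre_iff_isCritOnFibreB` (rfl at `bondsDet 𝐁`), `isCritOnFibreB_iff_hasDerivAt_zero`, ★ `IsCritOnFibreB.of_subset` (monotone), ★ `isCritOnFibre_genSet_of_isCritOnFibreB_lamBondsSeq`
(the door every (b)-consumer needs), `isCritOnFibreB_of_wilsonAction4_eq_zero` (non-vacuity).  §2 the Fermat step over a bond datum: `deriv_wilsonAction4_eq_zero_of_isMinimizerB`,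
`isCritOnFibreB_of_isMinimizerB_class17 ∕ _class6 ∕ _of_coDivClassOn` (minimal ⇒ critical over (1.7) ∕ (6) = (1.7)∧(1.9)).  §3 ★ `mem_lamBondsSeq_iff_lamBond` (the DICTIONARY: F0a's Domains-free `lamBondsSeq Ω k j` = `(domainsOfSeq Ω k hk).LamBond j` for a decreasing,
block-saturated sequence — kept here so that the root module `B15DeterminingSetsB` stays `Node00`-free), ★ `isCritOnFibreB_lamBondsSeq_iff` — at print's datum the predicate
READS «along every differentiable curve through `U` keeping `Ū^j = W_j` on `(domainsOfSeq s.Ω k).LamBond` bonds, `(A∘γ)′(0) = 0`» = the conclusion HSEAM displayed (✓125 :78–90), now a definition unfolded.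
HONEST FRAMING: one definition + rfl∕monotone bookkeeping + the elementary Fermat step; NO estimate of [15]∕[6] proved; nothing asserted; K0⁷ stub 1 NOT closed; N07 NOT discharged; counts unmoved
(typed 28∕28 · discharged 8∕28); one finite 𝕋⁴ programme at fixed ε — nothing continuum ∕ ℝ⁴ ∕ OS ∕ mass-gap ∕ Clay.  No `instance`, no `notation`, no `sorry`.

References: [15] (5)–(7) p. 278, p. 299, Prop. 8 p. 304; [III] (2.2) p. 255, (2.10)–(2.12) p. 256; [II] (2.3) p. 224; [I] (0.1) p. 251, (0.21) p. 256; [6] = [Balaban1985RegularSpaces] (1.7)–(1.9) p. 77.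
-/

noncomputable section

namespace Literature.MathematicalPhysics.QuantumFieldTheory.Balaban1983to89.Node00

open Filter Topology
open T4Continuum (T4Family)
open B15DeterminingSets B15DeterminingSetsB
open B5Eq118OneStroke (iterBlockOf)
open scoped Matrix.Norms.L2Operator

/-! ## §1 The criticality predicate on a fibre over a bond-level datum -/

section Critical

variable (F : T4Family) (N : ℕ) [NeZero N]

/-- ★ **«U IS A CRITICAL CONFIGURATION OF THE FUNCTIONAL (5) ON THE FIBRE 𝔅(𝐁ᵇ, W)» over a BOND-LEVEL determining datum `𝐁ᵇ j ⊆ bonds of T^{(j)}`**: along every curve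
`γ : ℝ → GaugeField (F.P K) 0 (SU N)` with `γ 0 = U`, differentiable at `0` as a curve of bond matrices, lying for `t` near `0` in the fibre `{U | AgreeOnB 𝔅 (Ū U) W}` («Ū^j = W_j on the
constrained bonds»), every derivative at `0` of `t ↦ A(γ t)` vanishes.  `Node00.IsCritOnFibre` is the instance `𝐁ᵇ := bondsDet 𝐁` (reading (b)); print's Prop. 8 hypothesis is the instance
`𝐁ᵇ := lamBondsSeq s.Ω k` ([II] (2.3)). [cite: Balaban1985Variational, (5)–(7) p.278, Prop. 8 p.304, Sect. F p.300; Balaban1988Convergent, (2.10)–(2.12) p.256; Balaban1984PropagatorsII, (2.3) p.224] -/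
def IsCritOnFibreB (K : ℕ) (𝔅 : BDetSet (F.P K)) (W : MSField (F.P K) (SU N)) (U : GaugeField (F.P K) 0 (SU N)) : Prop :=
  ∀ γ : ℝ → GaugeField (F.P K) 0 (SU N), γ 0 = U →
    DifferentiableAt ℝ (fun (t : ℝ) (b : PBond (F.P K) 0) => ((γ t b : SU N) : Matrix (Fin N) (Fin N) ℂ)) 0 →
      (∀ᶠ t in 𝓝 0, AgreeOnB 𝔅 (avgFamily (avOfRecord F N K) (γ t)) W) →
        ∀ a : ℝ, HasDerivAt (fun t => wilsonAction4 (γ t)) a 0 → a = 0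

variable {F N}

/-- `IsCritOnFibre F N K 𝔹` IS `IsCritOnFibreB F N K (bondsDet 𝔹)`, definitionally (the (b)-instance). [cite: Balaban1985Variational, Prop. 8 p.304; Balaban1988Convergent, (2.10) p.256] -/
theorem isCritOnFibre_iff_isCritOnFibreB {K : ℕ} (𝔹 : DetSet (F.P K)) (W : MSField (F.P K) (SU N)) (U : GaugeField (F.P K) 0 (SU N)) :
    IsCritOnFibre F N K 𝔹 W U ↔ IsCritOnFibreB F N K (bondsDet 𝔹) W U := Iff.rfl

/-- **THE PREDICATE IS THE USUAL «(A ∘ γ)′(0) = 0»** (twin of `isCritOnFibre_iff_hasDerivAt_zero`). [cite: Balaban1985Variational, (5)–(6) p.278, Prop. 8 p.304] -/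
theorem isCritOnFibreB_iff_hasDerivAt_zero {K : ℕ} {𝔅 : BDetSet (F.P K)} {W : MSField (F.P K) (SU N)} {U : GaugeField (F.P K) 0 (SU N)} :
    IsCritOnFibreB F N K 𝔅 W U ↔
      ∀ γ : ℝ → GaugeField (F.P K) 0 (SU N), γ 0 = U →
        DifferentiableAt ℝ (fun (t : ℝ) (b : PBond (F.P K) 0) => ((γ t b : SU N) : Matrix (Fin N) (Fin N) ℂ)) 0 →
          (∀ᶠ t in 𝓝 0, AgreeOnB 𝔅 (avgFamily (avOfRecord F N K) (γ t)) W) → HasDerivAt (fun t => wilsonAction4 (γ t)) 0 0 := by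
  refine ⟨fun h γ h0 hd hc => ?_, fun h γ h0 hd hc a ha => ha.unique (h γ h0 hd hc)⟩
  have hD := (differentiableAt_wilsonAction4_along hd).hasDerivAt
  rwa [h γ h0 hd hc _ hD] at hD

/-- ★ **MONOTONICITY IN THE DATUM**: FEWER constrained bonds (`𝔅₁ ⊆ 𝔅₂` pointwise) means MORE admissible curves, hence a STRONGER criticality: `IsCritOnFibreB 𝔅₁ → IsCritOnFibreB 𝔅₂`
(a curve keeping the `𝔅₂`-averages keeps the `𝔅₁`-averages). This is the direction every (b)-instance consumer of the K0 road needs from the print instance.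
[cite: Balaban1985Variational, (7) p.278, Prop. 8 p.304; Balaban1984PropagatorsII, (2.3) p.224; Balaban1988Convergent, (2.10) p.256] -/
theorem IsCritOnFibreB.of_subset {K : ℕ} {𝔅₁ 𝔅₂ : BDetSet (F.P K)} (h𝔅 : ∀ j, 𝔅₁ j ⊆ 𝔅₂ j) {W : MSField (F.P K) (SU N)} {U : GaugeField (F.P K) 0 (SU N)}
    (h : IsCritOnFibreB F N K 𝔅₁ W U) : IsCritOnFibreB F N K 𝔅₂ W U :=
  fun γ h0 hd hfib a ha => h γ h0 hd (hfib.mono fun _ ht => ht.anti h𝔅) a ha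

/-- ★ **THE DOOR EVERY (b)-CONSUMER NEEDS**: criticality on print's [II] (2.3) fibre (`lamBondsSeq Ω k`) implies criticality on the reading-(b) fibre of [III] (2.2)'s determining set
(`IsCritOnFibre … (genSet Ω k)`) — NO hypotheses (F0a `lamBondsSeq_subset_bondsDet`). (This seat's ✓`…N07CritMultiScaleLamBond.isCritOnFibre_genSet_of_critLam` :246 is the same fact in the
`CritLam` currency.) [cite: Balaban1984PropagatorsII, (2.3) p.224; Balaban1988Convergent, (2.2) p.255, (2.10) p.256; Balaban1985Variational, Prop. 8 p.304] -/
theorem isCritOnFibre_genSet_of_isCritOnFibreB_lamBondsSeq {K : ℕ} {Ω : ℕ → Set (Site (F.P K) 0)} {k : ℕ} {W : MSField (F.P K) (SU N)} {U : GaugeField (F.P K) 0 (SU N)}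
    (h : IsCritOnFibreB F N K (lamBondsSeq Ω k) W U) : IsCritOnFibre F N K (genSet Ω k) W U :=
  (isCritOnFibre_iff_isCritOnFibreB _ _ _).2 (h.of_subset (lamBondsSeq_subset_bondsDet Ω k))

/-- **NON-VACUITY**: a configuration of ZERO Wilson action is critical on every fibre through it, for every datum (Fermat at a global minimum).
[cite: Balaban1985Variational, (5) p.278 (A ≥ 0); Balaban1987RG1, (0.2) p.252] -/
theorem isCritOnFibreB_of_wilsonAction4_eq_zero {K : ℕ} {𝔅 : BDetSet (F.P K)} {W : MSField (F.P K) (SU N)} {U : GaugeField (F.P K) 0 (SU N)}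
    (hA : wilsonAction4 U = 0) : IsCritOnFibreB F N K 𝔅 W U := by
  intro γ h0 _ _ a ha
  refine IsLocalMin.hasDerivAt_eq_zero ?_ ha
  refine Filter.Eventually.of_forall fun t => ?_
  show wilsonAction4 (γ 0) ≤ wilsonAction4 (γ t)
  rw [h0, hA]
  exact wilsonAction4_nonneg _

end Critical

/-! ## §2 The Fermat step on a fibre over a bond datum: «minimal ⇒ critical» over print's classes -/

section Fermat

variable {P : Params} {G : Type*} [GaugeGroup G]

/-- A minimiser over `reg` lying in a smaller class `reg′ ⊆ reg` minimises over `reg′` (bond-datum twin of `Node00.IsMinimizer.of_subset_of_mem`). [cite: Balaban1988Convergent, (2.12) p.256 (bookkeeping)] -/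
theorem IsMinimizerB.of_subset_of_mem {av : ∀ j, Averaging P j G} {reg reg' : Set (GaugeField P 0 G)} {𝔅 : BDetSet P} {V : MSField P G} {U₀ : GaugeField P 0 G}
    (hsub : reg' ⊆ reg) (hmem : U₀ ∈ reg') (h : IsMinimizerB av reg 𝔅 V U₀) : IsMinimizerB av reg' 𝔅 V U₀ :=
  ⟨hmem, h.2.1, fun U hU hUV => h.2.2 U (hsub hU) hUV⟩

/-- **THE FERMAT STEP ON A FIBRE, bond datum** (twin of `deriv_wilsonAction4_eq_zero_of_isMinimizer`): a minimiser over `reg` on the fibre of `W` has `(A∘γ)′(t₀) = 0` along every curve through it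
that stays in `reg` and in the fibre near `t₀`. [cite: Balaban1985Variational, (5)–(6) p.278, p.299; Balaban1988Convergent, (2.12) p.256] -/
theorem deriv_wilsonAction4_eq_zero_of_isMinimizerB {av : ∀ j, Averaging P j G} {reg : Set (GaugeField P 0 G)} {𝔅 : BDetSet P}
    {W : MSField P G} {U : GaugeField P 0 G} (h : IsMinimizerB av reg 𝔅 W U)
    {γ : ℝ → GaugeField P 0 G} {t₀ : ℝ} (h0 : γ t₀ = U) (hreg : ∀ᶠ t in 𝓝 t₀, γ t ∈ reg)
    (hcons : ∀ᶠ t in 𝓝 t₀, AgreeOnB 𝔅 (avgFamily av (γ t)) W) {a : ℝ}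
    (ha : HasDerivAt (fun t => wilsonAction4 (γ t)) a t₀) : a = 0 := by
  refine IsLocalMin.hasDerivAt_eq_zero ?_ ha
  show ∀ᶠ t in 𝓝 t₀, wilsonAction4 (γ t₀) ≤ wilsonAction4 (γ t)
  filter_upwards [hreg, hcons] with t ht hc
  rw [h0]
  exact h.2.2 (γ t) ht hc

end Fermat

section MinimalCritical

variable {F : T4Family} {N : ℕ} [NeZero N]

/-- **«MINIMAL ⇒ CRITICAL» OVER (1.7) ON A BOND-DATUM FIBRE** (twin of `isCritOnFibre_of_isMinimizer_class17`; the class is curve-open, `eventually_mem_class17`).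
[cite: Balaban1985Variational, (6) p.278, p.299, Prop. 8 p.304; Balaban1985RegularSpaces, (1.7) p.77; Balaban1988Convergent, (2.12) p.256] -/
theorem isCritOnFibreB_of_isMinimizerB_class17 {K k : ℕ} {Ω : ℕ → Set (Site (F.P K) 0)} {r : ℕ → ℝ} {𝔅 : BDetSet (F.P K)}
    {W : MSField (F.P K) (SU N)} {U₀ : GaugeField (F.P K) 0 (SU N)}
    (h : IsMinimizerB (avOfRecord F N K) {U | ∀ n, n ≤ k → PlaqSmallOn (omegaPlaqs Ω n) (r n) U} 𝔅 W U₀) :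
    IsCritOnFibreB F N K 𝔅 W U₀ := by
  intro γ h0 hd hc a ha
  have hγ : ContinuousAt (fun t (b : PBond (F.P K) 0) => γ t b) 0 := continuousAt_of_differentiableAt_val hd
  have hU : ∀ n, n ≤ k → PlaqSmallOn (omegaPlaqs Ω n) (r n) (γ 0) := by
    rw [h0]
    exact h.1
  exact deriv_wilsonAction4_eq_zero_of_isMinimizerB h h0 (eventually_mem_class17 hγ hU) hc ha

/-- ★ **«MINIMAL ⇒ CRITICAL» OVER PRINT'S CLASS (6) = (1.7) ∧ (1.9) ON A BOND-DATUM FIBRE** (twin of `isCritOnFibre_of_isMinimizer_class6`) — with `𝔹 := lamBondsSeq s.Ω k` this is exactly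
«the minimiser of (5) under (7) is a critical configuration», the hypothesis of Prop. 8 as printed. [cite: Balaban1985Variational, (6)–(7) p.278, p.299, Prop. 8 p.304; Balaban1985RegularSpaces, (1.7)–(1.9) p.77; Balaban1988Convergent, (2.12) p.256] -/
theorem isCritOnFibreB_of_isMinimizerB_class6 {K k : ℕ} {Ω : ℕ → Set (Site (F.P K) 0)} {r : ℕ → ℝ} {ε : ℝ} {𝔅 : BDetSet (F.P K)}
    {W : MSField (F.P K) (SU N)} {U₀ : GaugeField (F.P K) 0 (SU N)}
    (h : IsMinimizerB (avOfRecord F N K) {U | (∀ n, n ≤ k → PlaqSmallOn (omegaPlaqs Ω n) (r n) U) ∧ Sect2.CoDivClassOn Ω k ε U} 𝔅 W U₀) :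
    IsCritOnFibreB F N K 𝔅 W U₀ := by
  intro γ h0 hd hc a ha
  have hγ : ContinuousAt (fun t (b : PBond (F.P K) 0) => γ t b) 0 := continuousAt_of_differentiableAt_val hd
  have hU : (∀ n, n ≤ k → PlaqSmallOn (omegaPlaqs Ω n) (r n) (γ 0)) ∧ Sect2.CoDivClassOn Ω k ε (γ 0) := by
    rw [h0]
    exact h.1
  exact deriv_wilsonAction4_eq_zero_of_isMinimizerB h h0 (eventually_mem_class6 hγ hU) hc ha

/-- A minimiser over the (1.7)-class that ALSO satisfies (1.9) at the class threshold is critical on the bond-datum fibre (twin of `isCritOnFibre_of_isMinimizer_of_coDivClassOn`).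
[cite: Balaban1985Variational, (6) p.278, p.299; Balaban1985RegularSpaces, (1.7)–(1.9) p.77] -/
theorem isCritOnFibreB_of_isMinimizerB_of_coDivClassOn {K k : ℕ} {Ω : ℕ → Set (Site (F.P K) 0)} {r : ℕ → ℝ} {ε : ℝ} {𝔅 : BDetSet (F.P K)}
    {W : MSField (F.P K) (SU N)} {U₀ : GaugeField (F.P K) 0 (SU N)}
    (h : IsMinimizerB (avOfRecord F N K) {U | ∀ n, n ≤ k → PlaqSmallOn (omegaPlaqs Ω n) (r n) U} 𝔅 W U₀) (h9 : Sect2.CoDivClassOn Ω k ε U₀) :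
    IsCritOnFibreB F N K 𝔅 W U₀ :=
  isCritOnFibreB_of_isMinimizerB_class6 (r := r) (ε := ε)
    (IsMinimizerB.of_subset_of_mem (reg' := {U | (∀ n, n ≤ k → PlaqSmallOn (omegaPlaqs Ω n) (r n) U) ∧ Sect2.CoDivClassOn Ω k ε U})
      (fun _ hU => hU.1) ⟨h.1, h9⟩ h)

end MinimalCritical

/-! ## §3 The reading at print's datum: the dictionary `lamBondsSeq ↔ (domainsOfSeq …).LamBond`, and HSEAM's displayed conclusion is `IsCritOnFibreB … (lamBondsSeq s.Ω k)` unfolded -/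

section Dictionary

variable {P : Params}

/-- ★ **DICTIONARY**: for a decreasing, block-saturated sequence (`k ≤ m + K`, `1 ≤ k`) the Domains-free datum IS the tree's [II] (2.3) family of `domainsOfSeq Ω k`:
`b ∈ lamBondsSeq Ω k j ↔ (domainsOfSeq Ω k hk).LamBond j b`. [cite: Balaban1984PropagatorsII, (2.3) p.224; Balaban1988Convergent, (2.2) p.255] -/
theorem mem_lamBondsSeq_iff_lamBond (Ω : ℕ → Set (Site P 0)) {k : ℕ} (hk : k ≤ P.m + P.K) (hk1 : 1 ≤ k)
    (hnest : ∀ i : ℕ, 1 ≤ i → i < k → Ω (i + 1) ⊆ Ω i)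
    (hsat : ∀ (j : ℕ) (x x' : Site P 0), 1 ≤ j → j ≤ k → iterBlockOf j x = iterBlockOf j x' → x ∈ Ω j → x' ∈ Ω j)
    (j : ℕ) (b : PBond P j) :
    b ∈ lamBondsSeq Ω k j ↔ (domainsOfSeq Ω k hk).LamBond j b := by
  have hsrc := lamSite_domainsOfSeq_iff_mem_genSet Ω hk hk1 hnest hsat j b.src
  have htgt := lamSite_domainsOfSeq_iff_mem_genSet Ω hk hk1 hnest hsat j b.tgt
  -- deepness in F0a's spelling: `Deep j y ↔ j < k ∧ blockOf y ∈ pts (j+1) (Ω (j+1))` (the `(j+1)`-block's centre lies in `Ω_{j+1}`; saturation at level `j+1`)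
  have hdeep : ∀ y : Site P j, (domainsOfSeq Ω k hk).Deep j y ↔ j < k ∧ blockOf y ∈ pts (j + 1) (Ω (j + 1)) := by
    intro y
    by_cases hj : j < k
    · show blockOf y ∈ (domainsOfSeq Ω k hk).Om (j + 1) ↔ _
      rw [mem_domainsOfSeq_Om_iff_centre Ω hk hnest hsat (by omega) (by omega)]
      exact ⟨fun h => ⟨hj, h⟩, fun h => h.2⟩
    · have hnd : ¬ (domainsOfSeq Ω k hk).Deep j y := (domainsOfSeq Ω k hk).not_deep_of_le (show (domainsOfSeq Ω k hk).k ≤ j from not_lt.mp hj) y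
      exact ⟨fun h => absurd h hnd, fun h => absurd h.1 hj⟩
  have hds := hdeep b.src
  have hdt := hdeep b.tgt
  -- `LamSite j y = (y ∈ Om j ∧ ¬Deep j y)`, `LamBond j b = ((src ∈ Om ∨ tgt ∈ Om) ∧ ¬Deep src ∧ ¬Deep tgt)`, `b ∈ bondsOf S = (src ∈ S ∨ tgt ∈ S)` — all by `Iff.rfl`
  constructor
  · rintro ⟨hm, hnd⟩
    have nds : ¬ (domainsOfSeq Ω k hk).Deep j b.src := fun h => (hnd (hds.1 h).1).1 (hds.1 h).2
    have ndt : ¬ (domainsOfSeq Ω k hk).Deep j b.tgt := fun h => (hnd (hdt.1 h).1).2 (hdt.1 h).2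
    refine ⟨?_, nds, ndt⟩
    rcases hm with h | h
    · exact Or.inl (hsrc.2 h).1
    · exact Or.inr (htgt.2 h).1
  · rintro ⟨hm, nds, ndt⟩
    refine ⟨?_, fun hjk => ⟨fun h => nds (hds.2 ⟨hjk, h⟩), fun h => ndt (hdt.2 ⟨hjk, h⟩)⟩⟩
    rcases hm with h | h
    · exact Or.inl (hsrc.1 ⟨h, nds⟩)
    · exact Or.inr (htgt.1 ⟨h, ndt⟩)

end Dictionary

section PrintDatum

variable {F : T4Family} {N : ℕ} [NeZero N]

/-- ★ **AT PRINT's DATUM THE PREDICATE IS THE (2.3)-CURVE CRITICALITY HSEAM DISPLAYED**: for a decreasing, block-saturated sequence (`1 ≤ k ≤ m + K`),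
`IsCritOnFibreB F N K (lamBondsSeq Ω k) W U` holds iff along every differentiable curve `γ` through `U` with `Ū^j(γ t) = W_j` on every `(domainsOfSeq Ω k hk).LamBond j` bond for `t` near `0`,
every derivative of `t ↦ A(γ t)` at `0` vanishes — VERBATIM the consequent of the K0 road's HSEAM binder (✓`…N07Prop8StepCoPGridGOfPremisesG` :78–90), which under the print datum is thus a
definition unfolded, not a hypothesis. [cite: Balaban1985Variational, (7) p.278, Prop. 8 p.304; Balaban1984PropagatorsII, (2.3) p.224; Balaban1988Convergent, (2.2) p.255] -/
theorem isCritOnFibreB_lamBondsSeq_iff {K : ℕ} {Ω : ℕ → Set (Site (F.P K) 0)} {k : ℕ} (hk : k ≤ (F.P K).m + (F.P K).K) (hk1 : 1 ≤ k)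
    (hnest : ∀ i : ℕ, 1 ≤ i → i < k → Ω (i + 1) ⊆ Ω i)
    (hsat : ∀ (j : ℕ) (x x' : Site (F.P K) 0), 1 ≤ j → j ≤ k → iterBlockOf j x = iterBlockOf j x' → x ∈ Ω j → x' ∈ Ω j)
    (W : MSField (F.P K) (SU N)) (U : GaugeField (F.P K) 0 (SU N)) :
    IsCritOnFibreB F N K (lamBondsSeq Ω k) W U ↔
      ∀ γ : ℝ → GaugeField (F.P K) 0 (SU N), γ 0 = U →
        DifferentiableAt ℝ (fun (t : ℝ) (b : PBond (F.P K) 0) => ((γ t b : SU N) : Matrix (Fin N) (Fin N) ℂ)) 0 →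
          (∀ᶠ t in 𝓝 (0 : ℝ), ∀ (j : ℕ) (c : PBond (F.P K) j), (domainsOfSeq Ω k hk).LamBond j c → avgFamily (avOfRecord F N K) (γ t) j c = W j c) →
            ∀ a : ℝ, HasDerivAt (fun t => wilsonAction4 (γ t)) a 0 → a = 0 := by
  have hiff : ∀ V : MSField (F.P K) (SU N), AgreeOnB (lamBondsSeq Ω k) V W ↔ ∀ (j : ℕ) (c : PBond (F.P K) j), (domainsOfSeq Ω k hk).LamBond j c → V j c = W j c :=
    fun V => ⟨fun h j c hc => h j c ((mem_lamBondsSeq_iff_lamBond Ω hk hk1 hnest hsat j c).2 hc),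
      fun h j c hc => h j c ((mem_lamBondsSeq_iff_lamBond Ω hk hk1 hnest hsat j c).1 hc)⟩
  constructor
  · intro h γ h0 hd hfib a ha
    exact h γ h0 hd (hfib.mono fun t ht => (hiff _).2 ht) a ha
  · intro h γ h0 hd hfib a ha
    exact h γ h0 hd (hfib.mono fun t ht => (hiff _).1 ht) a ha

end PrintDatum

end Literature.MathematicalPhysics.QuantumFieldTheory.Balaban1983to89.Node00

end
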